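import Summits.ResolutionOfSingularities.ResolutionOfSingularities.Theorems.WeightedInvariantWeightedThesisHypersurfaceStrategyTower
import HarnessLib

/-!
# Hypersurface centre CHOICES — the strategy interface without functoriality (door (β)/(ε), consumer-minimal)

Route `ResolutionOfSingularities/WeightedInvariant`, crux `Theses.WeightedInvariant.WeightedThesis`
(stmt-ResolutionOfSingularities-0569: resolution of every reduced separated scheme of finite type over
every perfect field of characteristic `p`), line `datum-glued-split`, lead c9, RESHAPE 9 — the objects.

RESHAPE 8 (lead c8, `Theorems/…HypersurfaceStrategy.lean`, `…HypersurfaceStrategyTower.lean`) ran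
Włodarczyk's cobordant tower for a hypersurface centre STRATEGY `HypersurfaceCentreStrategy p`: a centre
rule with `(iii)` regular weighted centre, `(ii')` generic point off the support, `(i)` functoriality for
smooth SURJECTIVE `k`-morphisms between pairs, `(T)` well-founded tower-step relation. Reading that tower
(`HypersurfaceStrategyTower.hasResolution_quotient_of_gradedAtlas`) shows that `(i)` is consumed at
exactly ONE place: `DatumToEmbedded.CentreHomogeneous.centre_isHomogeneous_of_strategy` — on a
`𝔾ₘʲ`-stable affine chart `W ⊆ Y` of the CURRENT pair (a `ℤʲ`-grading of `Γ(Y, W)` with the constants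
in degree `0` for which the ideal of the hypersurface is homogeneous) every piece of the centre is
homogeneous. Functoriality between DIFFERENT pairs is never read.

This file posits the correspondingly weaker interface, the consumer-minimal one (each remaining field is
read by the tower):

* `HypersurfaceCentreChoice p` — a centre rule `centre f X : ReesAlgebraData Y` (total) such that on
  every SINGULAR integral hypersurface pair over a perfect field of characteristic `p`: `(iii)` the centre
  is a regular weighted centre, `(ii')` the generic point of the hypersurface is off its support, `(H)` the
  centre is homogeneous for every torus chart of the pair (every `ℤʲ`-grading, any `j`, of every affine
  open `W ⊆ Y` with the constants in degree `0` and `X(W)` homogeneous), and `(T)` the tower-step relation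
  `HypersurfacePair.Step centre` (unchanged from RESHAPE 8) is well-founded over every perfect field of
  characteristic `p`. There is NO axiom relating the centres of two different pairs: the centre may be
  CHOSEN pair by pair (even non-canonically); only the towers of these choices must stop. This is the
  "torus in the state" door of the 0571 strategist's census (`Cruxes/WeightedConstruction/STRATEGY-CENSUS.md`
  §6(β), `NEGATIVE-c4.md` §3) in the form the route's tower can consume today: the torus of a tower stage
  is visible to the constructor exactly as the gradings of its affine charts, and `(H)` is torus-INVARIANCE
  of the centre.
* `HypersurfaceCentreChoice.ofStrategy` — every strategy is a choice (`(H)` is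
  `centre_isHomogeneous_of_strategy`, i.e. `(i)` applied to `act ⊔ 𝟙, pr ⊔ 𝟙 : T ⊔ Y → Y`); hence
  hypersurface datum ⇒ strategy ⇒ choice and `WeightedConstruction` (stmt-0571) ⇒ choice;
* `hyp_centre_isHomogeneous_of_hypersurfaceStrategy` (registered stub of the line, RESHAPE 9) — `(H)`
  for strategies, the content of "strategy ⇒ choice"; `hyp_nonempty_choice_of_hypersurfaceStrategy`.

The tower and the composition for choices are in
`Theorems/WeightedInvariantWeightedThesisHypersurfaceChoiceTower.lean`.
-/

noncomputable section

open CategoryTheory AlgebraicGeometry TopologicalSpace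
open Literature.AlgebraicGeometry.Resolution

set_option linter.dupNamespace false -- mandated namespace of this single-conjunct summit

namespace Summit.ResolutionOfSingularities.ResolutionOfSingularities.Theorems

/-! ## Hypersurface centre choices -/

/-- **Hypersurface centre choice in characteristic `p`** (object posited by line `datum-glued-split` of
crux `WeightedThesis`, RESHAPE 9 — the functoriality-free door): for every field `k`, every `k`-scheme
`f : Y → Spec k` and every ideal sheaf `X` on `Y` a Rees algebra `centre f X` on `Y` (total), such that,
for `k` perfect of characteristic `p`, `f` smooth separated quasi-compact and `X` a locally principal
ideal sheaf with integral, NON-REGULAR closed subscheme: `(iii)` the centre is a regular weighted centre,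
`(ii')` the generic point of the hypersurface is off its support, `(H)` for every affine open `W ⊆ Y` and
every `ℤʲ`-grading of `Γ(Y, W)` with the constants in degree `0` for which `X(W)` is homogeneous (a
`𝔾ₘʲ`-stable affine chart of the pair), every piece of the centre has homogeneous ideal of sections over
`W`, and `(T)` over every perfect field of characteristic `p` the tower-step relation
`HypersurfacePair.Step centre` (global cobordant blow-up of the centre, strict transform) is well-founded.
Compared with `HypersurfaceCentreStrategy p` (RESHAPE 8) the functoriality `(i)` for smooth surjective
morphisms BETWEEN pairs is replaced by the torus-invariance `(H)` INSIDE one pair, which is all the tower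
reads (`HypersurfaceChoiceTower.hasResolution_quotient_of_gradedAtlas`); every strategy is a choice
(`HypersurfaceCentreChoice.ofStrategy`). Shape: the centres of Abramovich–Temkin–Włodarczyk 2024 Thm. 1.1.1
/ Włodarczyk arXiv:2203.03090 Thm. 1.1.4 (6) ("functorial for group actions"), restricted to hypersurfaces,
with functoriality demoted to equivariance. EVIDENCE, not a claim. -/
structure HypersurfaceCentreChoice (p : ℕ) : Type 1 where
  /-- the weighted centre of `(Y, X)`, as a Rees algebra on `Y` (total) -/
  centre : ∀ ⦃k : Type⦄ [Field k] ⦃Y : Scheme.{0}⦄, (Y ⟶ Spec (.of k)) → Y.IdealSheafData →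
    ReesAlgebraData Y
  /-- `(iii)` [singular hypersurface pairs] the centre is a regular weighted centre -/
  isRegularWeightedCentre_centre : ∀ ⦃k : Type⦄ [Field k] [CharP k p] [PerfectField k]
    ⦃Y : Scheme.{0}⦄ (f : Y ⟶ Spec (.of k)) [Smooth f] [IsSeparated f] [QuasiCompact f]
    (X : Y.IdealSheafData), IsLocallyPrincipal X → IsIntegral X.subscheme →
    ¬ Scheme.IsRegular X.subscheme → (centre f X).IsRegularWeightedCentre
  /-- `(ii')` [singular hypersurface pairs, presented by a closed immersion `i`] the generic point of
  the hypersurface is off the centre -/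
  genericPoint_not_mem_support_centre : ∀ ⦃k : Type⦄ [Field k] [CharP k p] [PerfectField k]
    ⦃Y X : Scheme.{0}⦄ (f : Y ⟶ Spec (.of k)) [Smooth f] [IsSeparated f] [QuasiCompact f]
    (i : X ⟶ Y) [IsClosedImmersion i] [IsIntegral X], IsLocallyPrincipal i.ker →
    ¬ Scheme.IsRegular X → i (genericPoint X) ∉ (centre f i.ker).support
  /-- `(H)` [singular hypersurface pairs] the centre is homogeneous on every torus chart of the pair:
  for every affine open `W` and every `ℤʲ`-grading of `Γ(Y, W)` with the constants in degree `0` making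
  `X(W)` homogeneous, every piece of the centre is homogeneous over `W` -/
  centre_isHomogeneous : ∀ ⦃k : Type⦄ [Field k] [CharP k p] [PerfectField k] ⦃Y : Scheme.{0}⦄
    (f : Y ⟶ Spec (.of k)) [Smooth f] [IsSeparated f] [QuasiCompact f] (X : Y.IdealSheafData),
    IsLocallyPrincipal X → IsIntegral X.subscheme → ¬ Scheme.IsRegular X.subscheme →
    ∀ ⦃j : ℕ⦄ (W : Y.affineOpens) (𝒢 : (Fin j → ℤ) → AddSubgroup Γ(Y, W)) [GradedRing 𝒢],
    (∀ c : Γ(Spec (.of k), ⊤), f.appLE ⊤ W le_top c ∈ 𝒢 0) → (X.ideal W).IsHomogeneous 𝒢 →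
    ∀ n : ℕ, (((centre f X).piece n).ideal W).IsHomogeneous 𝒢
  /-- `(T)` over every perfect field of characteristic `p`, every cobordant tower stops -/
  wellFounded_step : ∀ ⦃k : Type⦄ [Field k] [CharP k p] [PerfectField k],
    WellFounded (HypersurfacePair.Step (k := k) fun ⦃Y : Scheme.{0}⦄ (f : Y ⟶ Spec (.of k)) X =>
      centre f X)

/-! ## `(H)` for a strategy -/

/-- **The centre of a hypersurface centre STRATEGY is homogeneous on every torus chart of a singular
hypersurface pair** (registered stub of line `datum-glued-split`, RESHAPE 9 — property `(H)` of a choice,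
for strategies): for `S : HypersurfaceCentreStrategy p`, a smooth separated quasi-compact `f : Y → Spec k`
over a perfect field of characteristic `p`, a locally principal ideal sheaf `X` with integral non-regular
`V(X)`, an affine open `W ⊆ Y` and a `ℤʲ`-grading `𝒢` of `Γ(Y, W)` with the constants in degree `0` and
`X(W)` homogeneous, every piece `(S.centre f X).piece n` has homogeneous ideal of sections over `W`. This is
`DatumToEmbedded.CentreHomogeneous.centre_isHomogeneous_of_strategy` (lead c8: functoriality `(i)` along the
smooth surjections `act ⊔ 𝟙_Y, pr ⊔ 𝟙_Y : T ⊔ Y → Y` of the chart), in registered form — the whole content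
of "strategy ⇒ choice". [cite: Wlodarczyk2022, Thm. 1.1.4 (6)] -/
theorem hyp_centre_isHomogeneous_of_hypersurfaceStrategy : ∀ {p : ℕ} (S : Summit.ResolutionOfSingularities.ResolutionOfSingularities.Theorems.HypersurfaceCentreStrategy p) {k : Type} [Field k] [CharP k p] [PerfectField k] {Y : AlgebraicGeometry.Scheme.{0}} (f : Y ⟶ AlgebraicGeometry.Spec (.of k)) [AlgebraicGeometry.Smooth f] [AlgebraicGeometry.IsSeparated f] [AlgebraicGeometry.QuasiCompact f] (X : Y.IdealSheafData), Literature.AlgebraicGeometry.Resolution.IsLocallyPrincipal X → AlgebraicGeometry.IsIntegral X.subscheme → ¬ Literature.AlgebraicGeometry.Resolution.Scheme.IsRegular X.subscheme → ∀ {j : ℕ} (W : Y.affineOpens) (𝒢 : (Fin j → ℤ) → AddSubgroup Γ(Y, W)) [GradedRing 𝒢], (∀ c : Γ(AlgebraicGeometry.Spec (.of k), ⊤), f.appLE ⊤ W le_top c ∈ 𝒢 0) → (X.ideal W).IsHomogeneous 𝒢 → ∀ n : ℕ, (((S.centre f X).piece n).ideal W).IsHomogeneous 𝒢 :=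
  fun S _ _ _ _ _ f _ _ _ X hX hXi hsing _ W 𝒢 _ h0 hXhom n =>
    DatumToEmbedded.CentreHomogeneous.centre_isHomogeneous_of_strategy S f X hX hXi hsing W 𝒢 h0 hXhom n

namespace HypersurfaceCentreChoice

variable {p : ℕ}

/-- **Every hypersurface centre strategy is a hypersurface centre choice** (keep the centre): `(iii)`,
`(ii')` and `(T)` are the strategy's; `(H)` is the homogeneity of the strategy's centre on graded ambient
charts (`DatumToEmbedded.CentreHomogeneous.centre_isHomogeneous_of_strategy`: functoriality `(i)` along
the two smooth surjections `act ⊔ 𝟙_Y, pr ⊔ 𝟙_Y : T ⊔ Y → Y` of a torus chart).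
[cite: Wlodarczyk2022, Thm. 1.1.4 (6)] -/
def ofStrategy (S : HypersurfaceCentreStrategy p) : HypersurfaceCentreChoice p where
  centre := S.centre
  isRegularWeightedCentre_centre := fun _ _ _ _ _ f _ _ _ X hX hXi hsing =>
    S.isRegularWeightedCentre_centre f X hX hXi hsing
  genericPoint_not_mem_support_centre := fun _ _ _ _ _ _ f _ _ _ i _ _ hX hsing =>
    S.genericPoint_not_mem_support_centre f i hX hsing
  centre_isHomogeneous := fun _ _ _ _ _ f _ _ _ X hX hXi hsing _ W 𝒢 _ h0 hXhom n =>
    hyp_centre_isHomogeneous_of_hypersurfaceStrategy S f X hX hXi hsing W 𝒢 h0 hXhom n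
  wellFounded_step := fun k _ _ _ => S.wellFounded_step (k := k)

/-- `ofStrategy` keeps the centre. [folklore] -/
@[simp] theorem ofStrategy_centre (S : HypersurfaceCentreStrategy p) :
    (ofStrategy S).centre = S.centre := rfl

/-- **Strategy ⇒ choice**: a hypersurface centre strategy in characteristic `p` gives a hypersurface
centre choice in characteristic `p`. [folklore] -/
theorem nonempty_of_nonempty_strategy (h : Nonempty (HypersurfaceCentreStrategy p)) :
    Nonempty (HypersurfaceCentreChoice p) :=
  h.map ofStrategy

/-- **Hypersurface datum ⇒ choice** (datum ⇒ strategy ⇒ choice). [folklore] -/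
theorem nonempty_of_hypersurfaceDatum (D : HypersurfaceResolutionDatum p) :
    Nonempty (HypersurfaceCentreChoice p) :=
  nonempty_of_nonempty_strategy (HypersurfaceStrategyTower.nonempty_strategy_of_hypersurfaceDatum D)

/-- **`WeightedConstruction` (stmt-0571) ⇒ choice**, prime by prime: a weighted resolution datum is a
hypersurface datum, which is a strategy, which is a choice. [folklore] -/
theorem nonempty_of_nonempty_datum (h : Nonempty (WeightedResolutionDatum p)) :
    Nonempty (HypersurfaceCentreChoice p) :=
  nonempty_of_nonempty_strategy (HypersurfaceStrategyTower.nonempty_strategy_of_datum h)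

end HypersurfaceCentreChoice

/-- **Registered form `hyp_nonempty_choice_of_hypersurfaceStrategy`** (registered stub of line
`datum-glued-split`, RESHAPE 9): a hypersurface centre strategy in characteristic `p` yields a
hypersurface centre choice in characteristic `p` — so RESHAPE 8's first stub implies RESHAPE 9's.
[folklore] -/
theorem hyp_nonempty_choice_of_hypersurfaceStrategy : ∀ {p : ℕ}, Summit.ResolutionOfSingularities.ResolutionOfSingularities.Theorems.HypersurfaceCentreStrategy p → Nonempty (Summit.ResolutionOfSingularities.ResolutionOfSingularities.Theorems.HypersurfaceCentreChoice p) :=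
  fun S => ⟨HypersurfaceCentreChoice.ofStrategy S⟩

end Summit.ResolutionOfSingularities.ResolutionOfSingularities.Theorems

end
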